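import Summits.BirchSwinnertonDyer.BirchSwinnertonDyer.Theorems.KolyvaginDepthDoorKolyvaginHeegnerSystem
import Summits.BirchSwinnertonDyer.BirchSwinnertonDyer.Theorems.KolyvaginDepthDoorKolyvaginDepthSupplyDoorOfClasses
import Summits.BirchSwinnertonDyer.BirchSwinnertonDyer.Theorems.KolyvaginDepthDoorKolyvaginDepthSupplyDoorNoTwistOfPrint
import HarnessLib

/-!
# Route `KolyvaginDepthDoor`, crux `KolyvaginDepthSupply` (stmt-BirchSwinnertonDyer-21765) —
# the hF-free, twist-free door WITH NO SYSTEM HYPOTHESIS: the bit `c_1(n₁) ≠ 0` at ANY datum of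
# level `n₁`, the five McCallum/Gross leaves by name, and rational points

Helper file (`--supports stmt-BirchSwinnertonDyer-21765 --as helper`); it closes nothing and BSD is
not proved by it.

Every hF-free door and row of this route so far (g5 `…DoorOfPrint`, g6 `…DoorNoTwistOfPrint(Depth)`,
`…DepthTableRowKitNoTwist`, the 18 + 9 rows `…RowsNoTwist*`) carries, besides the five named McCallum /
Gross leaves and the bit, a COMPATIBLE SYSTEM `d : ∀ n : ℕ, KolyvaginHeegnerData Dt β ι n` with four
coherence binders `hσ hS₁ hS₂ hemb` quantified over ALL `(m, l) : ℕ × ℕ` — a binder the tree could not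
discharge (indeed at `n = 0`, or at levels meeting `N`, no datum is even known to exist). PART 3 of this
series (`…KolyvaginHeegnerSystem.exists_kolyvaginHeegnerSystem_extending`) constructs, UNCONDITIONALLY, a
compatible system on all square-free inert levels THROUGH any given datum; this file re-runs the door on
it, so that the system binder DISAPPEARS:

* (file `…KolyvaginDepthSupplyDoorOfClasses`) `exists_hypothesesDepth_of_classes` — g5's
  `exists_hypothesesDepth_of_system` for an arbitrary class family `cl : ℕ → H¹(K, E[p^1])`;
* `discr_lt_neg_four_of_frame` — `d_K < −4` from `d_K ∉ {−3, −4}` and a frame (`4N ∣ β² − d_K`);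
* `shaCorank_eq_zero_of_kolyvaginClass_ne_zero_of_rank_le_of_datum` — **THE DOOR OF A DATUM (any
  depth)**: five named facts + ONE datum `d₁ : KolyvaginHeegnerData Dt β ι n₁` at a square-free product
  `n₁` of Kolyvagin primes with `d₁.kolyvaginClass hp 1 ≠ 0` + `ν(n₁) + 1 ≤ rank E(ℚ)` ⟹
  `corank_{ℤ_p} Ш(E/ℚ)[p^∞] = 0`, `rank E(ℚ) = ν + 1`, `rank E^{(d_K)}(ℚ) ≤ ν`, `E(ℚ)[p] = 0`,
  `Ш(E/ℚ)[p] = 0`, `#Sel_p(E/ℚ) = p^{ν+1}`;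
* `shaCorank_eq_zero_of_two_le_rank_of_kolyvaginClass_prime_ne_zero_of_datum` — the rank-2 slice /
  depth-table row: ONE Kolyvagin prime `ℓ`, ANY datum `d₁` of conductor `ℓ` with `c_1(ℓ) ≠ 0`, two
  independent points.

NET EFFECT per depth-table row: hypotheses = five S/M named leaves (`sign_conjAct_kolyvaginClass`,
`lemma43_kolyvaginClass_mem_selmerLocalKer`, `prop44_localOrder_kolyvaginClass_mul_eq`,
`lemma53_selmer_eigen_dependent_at`, `prop22_reciprocity_eigen_finset`) + the bit at the row's own datum
+ the points; NO Kolyvagin Thm. 4, NO twist point, NO system. Per-curve; conditional on the five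
facts; BSD is not proved by it.

References: [GrossLMS1991] §§3–5, §10; [McCallumLMS1991] Prop. 2.2, Cor. 3.2, Lemma 4.3, Prop. 4.4,
Lemma 5.3; [Kolyvagin1991MathAnn] Thm. 2.3; [WZhang2014] Notations (xii); [JetchevLauterStein2009] §3.6.
-/

set_option linter.dupNamespace false

noncomputable section

open scoped Classical

namespace Summit.BirchSwinnertonDyer.BirchSwinnertonDyer.Theorems.KolyvaginDepthDoor

open Literature.NumberTheory.EllipticCurves Literature.NumberTheory.EllipticCurves.ModularForms
  Literature.NumberTheory.EllipticCurves.KolyvaginDescent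
  Literature.NumberTheory.EllipticCurves.McCallum1991 WeierstrassCurve NumberField IsDedekindDomain

/-! ## The door of a datum -/

section Datum

variable {W : WeierstrassCurve ℚ} [W.IsElliptic] [W.IsGloballyMinimal] [NeZero (W.conductorNorm ℤ)]
  {K : Type} [Field K] [NumberField K]
  {Dt : ModularParametrizationData W (W.conductorNorm ℤ)} {β : ℤ} {ι : K →+* ℂ}

omit [W.IsElliptic] [W.IsGloballyMinimal] [NeZero (W.conductorNorm ℤ)] in
/-- `d_K < −4` for an imaginary quadratic `K` with `d_K ∉ {−3, −4}` admitting a frame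
(`4N ∣ β² − d_K` forces `d_K ≡ 0, 1 (mod 4)`) — Gross's standing `D ≠ 3, 4` in the form the ring
class tower files consume. [cite: GrossLMS1991, §1] -/
theorem discr_lt_neg_four_of_frame (hK : IsImaginaryQuadratic K) (h3 : NumberField.discr K ≠ -3)
    (h4 : NumberField.discr K ≠ -4) {N : ℕ} {β : ℤ}
    (hβ : (4 * N : ℤ) ∣ β ^ 2 - NumberField.discr K) : NumberField.discr K < -4 := by
  have hneg : NumberField.discr K < 0 := hK.discr_neg
  obtain ⟨c, hc⟩ := (dvd_mul_right (4 : ℤ) (N : ℤ)).trans hβ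
  rcases Int.even_or_odd β with ⟨k, hk⟩ | ⟨k, hk⟩
  · have hsq : β ^ 2 = 4 * (k * k) := by rw [hk]; ring
    generalize k * k = t at hsq
    omega
  · have hsq : β ^ 2 = 4 * (k * k + k) + 1 := by rw [hk]; ring
    generalize k * k + k = t at hsq
    omega

/-- **THE DOOR OF A DATUM (any depth; hF-free, twist-free, system-free).** `E/ℚ` globally minimal
without CM, `K` imaginary quadratic with `d_K ∉ {−3, −4}` and the Heegner hypothesis for `N_E`, `c`
its complex conjugation, `p` odd with `ρ̄_{E,p^n}` onto for all `n`, a frame `(Dt, β, ι)`. Granted the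
five named facts `sign_conjAct_kolyvaginClass` (Gross Prop. 5.4 (2)),
`lemma43_kolyvaginClass_mem_selmerLocalKer` (McCallum Lemma 4.3), `prop44_localOrder_kolyvaginClass_mul_eq`
(Prop. 4.4), `lemma53_selmer_eigen_dependent_at` (Lemma 5.3), `prop22_reciprocity_eigen_finset`
(Prop. 2.2): if ONE datum `d₁` of conductor `n₁` — `n₁` a square-free product of Kolyvagin primes
(Zhang's form) with `ν` prime factors — has `d₁.kolyvaginClass hp 1 ≠ 0`, and `ν + 1 ≤ rank E(ℚ)`,
then `corank_{ℤ_p} Ш(E/ℚ)[p^∞] = 0`, `rank E(ℚ) = ν + 1`, `rank E^{(d_K)}(ℚ) ≤ ν`, `#E(ℚ)[p] = 1`,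
`Ш(E/ℚ)[p] = 0`, `#Sel_p(E/ℚ) = p^{ν+1}`. Proof: extend `d₁` to a compatible system on all square-free
inert levels (`exists_kolyvaginHeegnerSystem_extending`), feed its classes to
`exists_hypothesesDepth_of_classes` with the Euler-system hypotheses discharged by the five facts
(Prop. 4.4 on the compatible pairs `(d m, d (mℓ))`), and read the result over `ℚ`
(`door_of_hypothesesDepth`). CONDITIONAL on the five named facts; per-curve; BSD is not proved by it.
[cite: Kolyvagin1991MathAnn, Thm. 2.3] [cite: McCallumLMS1991, §§2–5 (Prop. 2.2, Cor. 3.2, Lemma 4.3, Prop. 4.4, Lemma 5.3)]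
[cite: GrossLMS1991, §5 (5.1), §10] -/
theorem shaCorank_eq_zero_of_kolyvaginClass_ne_zero_of_rank_le_of_datum
    (h54 : sign_conjAct_kolyvaginClass) (h43 : lemma43_kolyvaginClass_mem_selmerLocalKer)
    (h44 : prop44_localOrder_kolyvaginClass_mul_eq) (h53 : lemma53_selmer_eigen_dependent_at)
    (h22 : prop22_reciprocity_eigen_finset)
    (hcm : ¬ W.HasCM) (hK : IsImaginaryQuadratic K) (hD3 : NumberField.discr K ≠ -3)
    (hD4 : NumberField.discr K ≠ -4) (hH : SatisfiesHeegnerHypothesis (W.conductorNorm ℤ) K)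
    (p : ℕ) [hp : Fact p.Prime] (hp2 : p ≠ 2)
    (htower : ∀ n : ℕ, W.HasSurjectiveModNGaloisRep (p ^ n : ℕ))
    (c : K ≃ₐ[ℚ] K) (hc : c ≠ 1) (hcc : c * c = 1)
    {n₁ : ℕ} (hn₁ : Squarefree n₁)
    (hk₁ : ∀ q ∈ n₁.primeFactors, Zhang2014.IsKolyvaginPrime (W.conductorNorm ℤ) W K p q)
    (d₁ : KolyvaginHeegnerData Dt β ι n₁) (hne : d₁.kolyvaginClass hp.out 1 ≠ 0)
    (hrank : n₁.primeFactors.card + 1 ≤ W.mordellWeilRank) :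
    W.shaCorank p = 0 ∧ W.mordellWeilRank = n₁.primeFactors.card + 1 ∧
      (W.quadraticTwist (NumberField.discr K : ℚ)).mordellWeilRank ≤ n₁.primeFactors.card ∧
      Nat.card ↥(AddSubgroup.torsionBy W.toAffine.Point ((p ^ 1 : ℕ) : ℤ)) = 1 ∧
      W.sha ⊓ AddSubgroup.torsionBy W.galH1 ((p ^ 1 : ℕ) : ℤ) = ⊥ ∧
      Nat.card ↥(selmerGroup W ((p ^ 1 : ℕ) : ℤ)) = p ^ (n₁.primeFactors.card + 1) := by
  -- `ℓ' ∈ S₁(1)` for every Kolyvagin prime (Zhang's `0 < M(ℓ')`), and Kolyvagin primes are inert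
  have hS1 : ∀ {n : ℕ}, (∀ q ∈ n.primeFactors, Zhang2014.IsKolyvaginPrime (W.conductorNorm ℤ) W K p q) →
      ∀ q ∈ n.primeFactors, Zhang2014.IsKolyvaginPrime (W.conductorNorm ℤ) W K p q ∧
        1 ≤ Zhang2014.kolyvaginIndex W p q :=
    fun h q hq ↦ ⟨h q hq, (h q hq).2.2.2.2.2⟩
  have hinert : ∀ {n : ℕ},
      (∀ q ∈ n.primeFactors, Zhang2014.IsKolyvaginPrime (W.conductorNorm ℤ) W K p q) →
      ∀ q ∈ n.primeFactors, (Ideal.span {(q : 𝓞 K)}).IsPrime :=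
    fun h q hq ↦ (h q hq).2.2.2.2.1
  have hd4 : NumberField.discr K < -4 := discr_lt_neg_four_of_frame hK hD3 hD4 d₁.dvd_sq_sub
  -- the compatible system through `d₁`
  obtain ⟨d, hd₁, hcoh⟩ :=
    exists_kolyvaginHeegnerSystem_extending hK hd4 hH Dt β ι hn₁ (hinert hk₁) d₁
  -- its class family (junk `0` off the good levels)
  let cl : ℕ → galH1Torsion (W.baseChange K) ((p ^ 1 : ℕ) : ℤ) := fun n ↦
    if h : Squarefree n ∧ ∀ q ∈ n.primeFactors, (Ideal.span {(q : 𝓞 K)}).IsPrime then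
      (d n h.1 h.2).kolyvaginClass hp.out 1 else 0
  have hcl : ∀ (n : ℕ) (hn : Squarefree n)
      (hin : ∀ q ∈ n.primeFactors, (Ideal.span {(q : 𝓞 K)}).IsPrime),
      cl n = (d n hn hin).kolyvaginClass hp.out 1 := fun n hn hin ↦ by
    simp only [cl, dif_pos (show Squarefree n ∧ _ from ⟨hn, hin⟩)]
  -- the sign law (Gross Prop. 5.4 (2))
  obtain ⟨ε, hε, hsign⟩ := h54 W hcm K hK hD3 hD4 hH p hp2 htower c hc Dt β ι 1 le_rfl
  -- `h44`: McCallum Prop. 4.4 "in particular" for the compatible pairs `(d m, d (m l))`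
  have hh44 : ∀ (l m : ℕ), Squarefree (l * m) →
      (∀ q ∈ (l * m).primeFactors, Zhang2014.IsKolyvaginPrime (W.conductorNorm ℤ) W K p q) →
      Zhang2014.IsKolyvaginPrime (W.conductorNorm ℤ) W K p l →
      ∀ v : HeightOneSpectrum (𝓞 K), (l : 𝓞 K) ∈ v.asIdeal →
        (cl (l * m) ∈ selmerLocalKer (W.baseChange K) (v.adicCompletion K) ((p ^ 1 : ℕ) : ℤ) ↔
          cl m ∈ (W.baseChange K).torsionLocalKer (v.adicCompletion K) ((p ^ 1 : ℕ) : ℤ)) := by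
    intro l m hsq hk hl v hv
    have hsq' : Squarefree (m * l) := by rwa [Nat.mul_comm] at hsq
    have hk' : ∀ q ∈ (m * l).primeFactors, Zhang2014.IsKolyvaginPrime (W.conductorNorm ℤ) W K p q ∧
        1 ≤ Zhang2014.kolyvaginIndex W p q := by
      rw [Nat.mul_comm]
      exact hS1 hk
    have hkml : ∀ q ∈ (m * l).primeFactors, Zhang2014.IsKolyvaginPrime (W.conductorNorm ℤ) W K p q :=
      fun q hq ↦ (hk' q hq).1
    have hm : Squarefree m := hsq'.squarefree_of_dvd (dvd_mul_right m l)
    have hkm : ∀ q ∈ m.primeFactors, Zhang2014.IsKolyvaginPrime (W.conductorNorm ℤ) W K p q :=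
      fun q hq ↦ hkml q (Nat.mem_primeFactors.mpr ⟨Nat.prime_of_mem_primeFactors hq,
        (Nat.dvd_of_mem_primeFactors hq).trans (dvd_mul_right m l), hsq'.ne_zero⟩)
    have hlm : ¬ l ∣ m := by
      intro hdiv
      have hll : l * l ∣ l * m := Nat.mul_dvd_mul_left l hdiv
      exact hl.1.not_isUnit (hsq l hll)
    obtain ⟨hσ, hS₁, hS₂, hemb⟩ :=
      hcoh m (m * l) hm (hinert hkm) hsq' (hinert hkml) (dvd_mul_right m l)
    have hA := kolyvaginClass_mul_mem_selmerLocalKer_iff_of_prop44 h44 W hcm K hK hD3 hD4 hH p hp2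
      htower Dt β ι 1 le_rfl m l hsq' hl.1 hlm hk' (d m hm (hinert hkm)) (d (m * l) hsq' (hinert hkml))
      hσ hS₁ hS₂ hemb v hv
    have hB := kolyvaginClass_mul_mem_torsionLocalKer_iff_of_prop44 h44 W hcm K hK hD3 hD4 hH p hp2
      htower Dt β ι 1 le_rfl m l hsq' hl.1 hlm hk' (d m hm (hinert hkm)) (d (m * l) hsq' (hinert hkml))
      hσ hS₁ hS₂ hemb v hv
    rw [Nat.mul_comm l m, hcl (m * l) hsq' (hinert hkml), hcl m hm (hinert hkm)]
    exact hA.trans hB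
  obtain ⟨S, hSel, hSp, hSc, hSK, hSτ⟩ := exists_hypothesesDepth_of_classes hcm hK p hp2 htower c hc
    hcc cl ε hε
    (fun n hn hk ↦ by rw [hcl n hn (hinert hk)]; exact hsign n hn (hS1 hk) _)
    (fun n hn hk v hv ↦ by
      rw [hcl n hn (hinert hk)]
      exact (h43 W hcm K hK hD3 hD4 hH p hp2 htower Dt β ι 1 le_rfl n hn (hS1 hk) _).1 v hv)
    (fun n hn hk w ↦ by
      rw [hcl n hn (hinert hk)]
      exact (h43 W hcm K hK hD3 hD4 hH p hp2 htower Dt β ι 1 le_rfl n hn (hS1 hk) _).2 w)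
    hh44
    (fun l hl e he s₁ hs₁ hτ₁ s₂ hs₂ hτ₂ ↦ h53 W hcm K hK p hp2 htower c hc 1 le_rfl l hl
      hl.2.2.2.2.2 e he s₁ hs₁ hτ₁ s₂ hs₂ hτ₂)
    (fun T hT l hlT e he x hx hoff hinf s hs hτs hsT v hv hsv ↦
      mem_selmerLocalKer_of_not_mem_torsionLocalKer_of_prop22 h22 W hcm K hK p hp2 htower c hc T hT
        hlT e he x hx hoff hinf s hs hτs hsT v hv hsv)
  have hsupp : KolSupp S.Kol n₁ := by rw [hSK]; exact ⟨hn₁, hk₁⟩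
  have hne' : S.c n₁ ≠ 0 := by rw [hSc, hcl n₁ hn₁ (hinert hk₁), hd₁]; exact hne
  exact door_of_hypothesesDepth W K hK.1 c hc p hp2 (pow_one p) S hSel hSp hSτ hsupp hne' hrank

/-- **The rank-2 slice / depth-table row OF A DATUM** (hF-free, twist-free, system-free): same setting;
ONE Kolyvagin prime `ℓ` (Zhang's congruence form), ANY datum `d₁ : KolyvaginHeegnerData Dt β ι ℓ`
with `d₁.kolyvaginClass hp 1 ≠ 0`, and two independent points on `E(ℚ)` give
`corank_{ℤ_p} Ш(E/ℚ)[p^∞] = 0`, `rank E(ℚ) = 2`, `rank E^{(d_K)}(ℚ) ≤ 1`, `#E(ℚ)[p] = 1`,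
`Ш(E/ℚ)[p] = 0`, `#Sel_p(E/ℚ) = p²`. CONDITIONAL on the five named facts; per-curve; BSD is not proved
by it. [cite: Kolyvagin1991MathAnn, Thm. 2.3] [cite: McCallumLMS1991, §§2–5]
[cite: JetchevLauterStein2009, §3.6 (arXiv:0707.0032)] -/
theorem shaCorank_eq_zero_of_two_le_rank_of_kolyvaginClass_prime_ne_zero_of_datum
    (h54 : sign_conjAct_kolyvaginClass) (h43 : lemma43_kolyvaginClass_mem_selmerLocalKer)
    (h44 : prop44_localOrder_kolyvaginClass_mul_eq) (h53 : lemma53_selmer_eigen_dependent_at)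
    (h22 : prop22_reciprocity_eigen_finset)
    (hcm : ¬ W.HasCM) (hK : IsImaginaryQuadratic K) (hD3 : NumberField.discr K ≠ -3)
    (hD4 : NumberField.discr K ≠ -4) (hH : SatisfiesHeegnerHypothesis (W.conductorNorm ℤ) K)
    (p : ℕ) [hp : Fact p.Prime] (hp2 : p ≠ 2)
    (htower : ∀ n : ℕ, W.HasSurjectiveModNGaloisRep (p ^ n : ℕ))
    (c : K ≃ₐ[ℚ] K) (hc : c ≠ 1) (hcc : c * c = 1)
    {ℓ : ℕ} (hℓ : Zhang2014.IsKolyvaginPrime (W.conductorNorm ℤ) W K p ℓ)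
    (d₁ : KolyvaginHeegnerData Dt β ι ℓ) (hne : d₁.kolyvaginClass hp.out 1 ≠ 0)
    (h2 : 2 ≤ W.mordellWeilRank) :
    W.shaCorank p = 0 ∧ W.mordellWeilRank = 2 ∧
      (W.quadraticTwist (NumberField.discr K : ℚ)).mordellWeilRank ≤ 1 ∧
      Nat.card ↥(AddSubgroup.torsionBy W.toAffine.Point (p : ℤ)) = 1 ∧
      W.sha ⊓ AddSubgroup.torsionBy W.galH1 (p : ℤ) = ⊥ ∧
      Nat.card ↥(selmerGroup W (p : ℤ)) = p ^ 2 := by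
  have hcard : ℓ.primeFactors.card = 1 := by rw [hℓ.1.primeFactors, Finset.card_singleton]
  have h := shaCorank_eq_zero_of_kolyvaginClass_ne_zero_of_rank_le_of_datum h54 h43 h44 h53 h22 hcm
    hK hD3 hD4 hH p hp2 htower c hc hcc hℓ.1.prime.squarefree (fun q hq ↦ by
      rw [hℓ.1.primeFactors, Finset.mem_singleton] at hq
      exact hq ▸ hℓ) d₁ hne (by rw [hcard]; exact h2)
  rw [hcard, pow_one] at h
  exact h

end Datum

end Summit.BirchSwinnertonDyer.BirchSwinnertonDyer.Theorems.KolyvaginDepthDoor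

end
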